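import Summits.CriticalPhenomena.CardyFormulaZ2.Theorems.CardyQContinuationUniformZeroFreeArcEnvelope
import Summits.CriticalPhenomena.CardyFormulaZ2.Theorems.CardyQContinuationUniformZeroFreeOddsConeSector
import Summits.CriticalPhenomena.CardyFormulaZ2.Theorems.CardyQContinuationUniformZeroFreeJets

/-!
# Envelope of the uniform-jets stub (crux `UniformZeroFree`, stmt-CriticalPhenomena-5559)

Notation of the route `CardyQContinuation`: for a conformal rectangle `R`, mesh `δ` and complex
`s`, `w_s(ω) = s^(|ω| + 2 k_B(ω))` is the self-dual arc weight of a bond configuration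
`ω ⊆ E(Ω_δ)` (arcs `(ab)_δ ∪ (cd)_δ` jointly wired), `Z_δ(s) = Σ_ω w_s(ω)` the arc partition
function, `N_δ(s) = Σ_{ω ∈ C_δ} w_s(ω)` its crossing-restricted part, `P_δ = N_δ/Z_δ` the crossing
ratio and `T_ρ` the complex `ρ`-neighbourhood of the real segment `s ∈ [1, √2]`.  The crux asks for
`Z_δ ≠ 0` and `‖P_δ‖ ≤ M` on `T_ρ`, uniformly in small `δ`.

The registered stub `stub_jetsBounded` of the line `birth` (v2) of the crux asks for `M, A ≥ 0`
with `‖P_δ^{(k)}(t)‖ ≤ M · k! · A^k` for all small `δ`, every REAL `t ∈ [1, √2]` and every order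
`k` (together with arc zero-freeness it is equivalent to the crux: Taylor expansion one way,
Cauchy's estimates the other).  The `k`-th jet of `log`-odds at a real point is a difference of
`k`-th conditional cumulants of `L = |ω| + 2k_B` under the critical FK measure `φ_{s=t}` given
`C_δᶜ` resp. `C_δ`; no `δ`-uniform, `k`-uniform control of these is in print.  This file proves the
provable ENVELOPE of the stub and links it BY NAME to the route:

* `jets_order_zero`, `jets_order_zero_eventually` — order `0` holds with `M = 1`, uniformly in
  `δ`: at real `t > 0`, `Z_δ(t) > 0` and `0 ≤ N_δ(t) ≤ Z_δ(t)` (`arcZ_realAxis`);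
* `jets_of_thickening_bound` — the Cauchy step, per `δ`: if `Z_δ ≠ 0` and `‖N_δ/Z_δ‖ ≤ M` on
  `T_ρ`, then `‖P_δ^{(k)}(t)‖ ≤ M · k! · (2/ρ)^k` on the segment, all `k` (the disc `|s − t| < ρ`
  lies in `T_ρ`, `P_δ` is a quotient of polynomials with non-vanishing denominator there, and
  `Complex.norm_iteratedDeriv_le_of_forall_mem_sphere_norm_le` applies on the circle of radius
  `ρ/2`: `norm_iteratedDeriv_le_of_forall_mem_ball`, `differentiableOn_ratio` of the sibling file
  `…UniformZeroFreeJets`);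
* `jets_pointwise` — the stub POINTWISE in `δ` (quantifiers `∃ M A` and `∀ δ` swapped): from the
  pointwise crux `arcZ_crux_pointwise`; so the entire content of the stub is the uniformity of
  `M, A` in `δ`;
* `jets_firstJetAtOneBounded` — the stub implies the route item `FirstJetAtOneBounded`
  (stmt-CriticalPhenomena-7102: `‖P′_δ(1)‖` bounded as `δ → 0⁺`), i.e. `k = 1`, `t = 1`;
* `jets_firstJetAtSqrtTwoBounded` — likewise `‖P′_δ(√2)‖` stays bounded (`k = 1`, `t = √2`; the
  route item `FirstJetConverges`, stmt-CriticalPhenomena-5561, asserts convergence, which is not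
  claimed here);
* `jets_fixedOrderBounded` — every fixed-order slice: `sup_{t ∈ [1,√2]} ‖P_δ^{(k)}(t)‖` bounded as
  `δ → 0⁺`, for each `k`;
* `jets_of_local_extension` — a sufficient condition NOT mentioning zeros of `Z_δ`: if for all
  small `δ` and every `t ∈ [1, √2]` the germ of `P_δ` at `t` extends to a holomorphic function
  bounded by `M` on the disc `|s − t| < r` (`r, M` uniform), then the stub holds with `A = 2/r`
  (Cauchy; the jets only see the germ, `Filter.EventuallyEq.iteratedDeriv_eq`).  So, unlike the
  crux, the stub tolerates zeros of `Z_δ` near the segment provided `N_δ` vanishes there to the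
  same order; conversely the stub gives such extensions by Taylor summation (radius `1/A`, bound
  `2M` on `|s − t| ≤ 1/(2A)`, the line's glue `norm_le_of_jets`), not repeated here;
* `jets_mul_deriv_ratio` — the first jet everywhere (not only at `s = 1`, cf.
  `deriv_crossingRatio_one`): for `Z_δ(s) ≠ 0`,
  `s · P′_δ(s) = (Σ 𝟙_C L s^L)/Z_δ − P_δ(s) · (Σ L s^L)/Z_δ` (`L = |ω| + 2k_B`), i.e. at real
  `t > 0`, `t P′_δ(t) = Cov_{φ_t}(𝟙_{C_δ}, L) = P_δ(1 − P_δ)(E_t[L | C_δ] − E_t[L | C_δᶜ])` — the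
  `k = 1` case of "jets of `log`-odds = conditional cumulant differences", the quantity the stub
  bounds at order one, segment-wide (generic form `jets_mul_deriv_ratio_finset`).
* `jets_crux_sector`, `jets_explicit` — the TRIVIAL RATE: in the explicit neighbourhood of radius
  `ρ_δ = 1/(4(D_δ + 1))`, `D_δ = |E(Ω_δ)| + 2|V(Ω_δ)| ≥ deg`, of the segment one has `Z_δ ≠ 0` and
  `‖N_δ/Z_δ‖ ≤ 1` (sector positivity `Re(s^p conj s^q) ≥ 0` for `p, q ≤ D_δ`, `D_δ|arg s| ≤ π/2`, from
  the sibling file `…OddsConeSector`), hence `‖P_δ^{(k)}(t)‖ ≤ k! · (8(D_δ + 1))^k` on the segment: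
  the stub holds trivially with `M = 1` and `A_δ = 8(D_δ + 1) ≍ δ⁻²`, and its content is to make
  `A` independent of `δ`.

All statements are written on the `dsimp only`-normal form of the route's `let w; let Z; let N`
bindings (the form in which the stub is registered), so they speak about literally the same terms.
-/

namespace Summit.CriticalPhenomena.CardyFormulaZ2.Theorems.UniformZeroFree

open Filter Metric Set
open scoped Topology Nat ComplexConjugate Real
open Literature.Probability.LatticeModels Literature.Probability.Percolation
open Literature.Probability.RandomPlanarGeometry
open Summit.CriticalPhenomena.CardyFormulaZ2.Theorems.CardyQContinuation
open Summit.CriticalPhenomena.CardyFormulaZ2.Theses.CardyQContinuation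

/-! ## A geometric fact -/

/-- Points of the disc of radius `r` about a real point `t ∈ [1, √2]` lie in the thickening
`T_r` of the segment. [folklore] -/
theorem jets_ball_ofReal_subset_thickening {t : ℝ} (ht : t ∈ Set.Icc (1:ℝ) (Real.sqrt 2))
    (r : ℝ) :
    ball (t : ℂ) r ⊆ Metric.thickening r (((↑) : ℝ → ℂ) '' Set.Icc (1:ℝ) (Real.sqrt 2)) := by
  intro s hs
  rw [Metric.mem_thickening_iff]
  exact ⟨(t : ℂ), ⟨t, ht, rfl⟩, hs⟩

/-! ## The envelope on the route's objects -/

/-- **(J1) Order `0`, uniformly in `δ`.** For a conformal rectangle `R`, mesh `δ > 0` and real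
`t > 0`, the `0`-th jet of the crossing ratio is `P_δ(t)` itself and `‖P_δ(t)‖ ≤ 1`: at a real
positive point `Z_δ(t)` is a strictly positive real and `0 ≤ N_δ(t) ≤ Z_δ(t)` (`arcZ_realAxis`).
So the `k = 0` slice of the stub `stub_jetsBounded` holds with `M = 1`. [folklore] -/
theorem jets_order_zero : ∀ R : Literature.Probability.RandomPlanarGeometry.ConformalRectangle, ∀ δ : ℝ, 0 < δ → ∀ t : ℝ, 0 < t → ‖iteratedDeriv 0 (fun s ↦ (∑ᶠ ω ∈ 𝒫 (Literature.Probability.LatticeModels.discreteDomainGraph R.carrier δ).edgeSet, (Literature.Probability.Percolation.discreteCrossing R.carrier δ (R.arc 0) (R.arc 2)).indicator (fun ω ↦ s ^ (ω.ncard + 2 * Nat.card ((Literature.Probability.Percolation.openGraph ω ⊔ Literature.Probability.LatticeModels.wired (Literature.Probability.LatticeModels.discreteArc R.carrier δ (R.arc 0) ∪ Literature.Probability.LatticeModels.discreteArc R.carrier δ (R.arc 2))).induce (Literature.Probability.LatticeModels.meshDomain R.carrier δ)).ConnectedComponent)) ω) / (∑ᶠ ω ∈ 𝒫 (Literature.Probability.LatticeModels.discreteDomainGraph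 R.carrier δ).edgeSet, s ^ (ω.ncard + 2 * Nat.card ((Literature.Probability.Percolation.openGraph ω ⊔ Literature.Probability.LatticeModels.wired (Literature.Probability.LatticeModels.discreteArc R.carrier δ (R.arc 0) ∪ Literature.Probability.LatticeModels.discreteArc R.carrier δ (R.arc 2))).induce (Literature.Probability.LatticeModels.meshDomain R.carrier δ)).ConnectedComponent))) (t : ℂ)‖ ≤ 1 := by
  intro R δ hδ t ht
  have h := arcZ_realAxis
  dsimp only at h
  simp only [iteratedDeriv_zero]
  exact (h R δ hδ t ht).2.2

/-- **(J1') Order `0` in the stub's format.** For every conformal rectangle, for all small `δ > 0`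
and every real `t ∈ [1, √2]`, `‖(N_δ/Z_δ)^{(0)}(t)‖ ≤ 1` — the `k = 0` case of `stub_jetsBounded`
with `M = 1`, uniformly in `δ`. [folklore] -/
theorem jets_order_zero_eventually : ∀ R : Literature.Probability.RandomPlanarGeometry.ConformalRectangle, ∀ᶠ δ in nhdsWithin (0:ℝ) (Set.Ioi 0), ∀ t ∈ Set.Icc (1:ℝ) (Real.sqrt 2), ‖iteratedDeriv 0 (fun s ↦ (∑ᶠ ω ∈ 𝒫 (Literature.Probability.LatticeModels.discreteDomainGraph R.carrier δ).edgeSet, (Literature.Probability.Percolation.discreteCrossing R.carrier δ (R.arc 0) (R.arc 2)).indicator (fun ω ↦ s ^ (ω.ncard + 2 * Nat.card ((Literature.Probability.Percolation.openGraph ω ⊔ Literature.Probability.LatticeModels.wired (Literature.Probability.LatticeModels.discreteArc R.carrier δ (R.arc 0) ∪ Literature.Probability.LatticeModels.discreteArc R.carrier δ (R.arc 2))).induce (Literature.Probability.LatticeModels.meshDomain R.carrier δ)).ConnectedComponent)) ω) / (∑ᶠ ω ∈ 𝒫 (Literature.Probability.LatticeModels.discreteDomainGraph R.carrier δ).edgeSet,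 s ^ (ω.ncard + 2 * Nat.card ((Literature.Probability.Percolation.openGraph ω ⊔ Literature.Probability.LatticeModels.wired (Literature.Probability.LatticeModels.discreteArc R.carrier δ (R.arc 0) ∪ Literature.Probability.LatticeModels.discreteArc R.carrier δ (R.arc 2))).induce (Literature.Probability.LatticeModels.meshDomain R.carrier δ)).ConnectedComponent))) (t : ℂ)‖ ≤ 1 := by
  intro R
  have hpos : ∀ᶠ δ in 𝓝[>] (0 : ℝ), 0 < δ := self_mem_nhdsWithin
  filter_upwards [hpos] with δ hδ
  intro t ht
  exact jets_order_zero R δ hδ t (one_pos.trans_le ht.1)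

/-- **(J2₀) The Cauchy step, per `δ`.** For a conformal rectangle `R`, mesh `δ > 0`, radius
`ρ > 0` and bound `M`: if `Z_δ(s) ≠ 0` and `‖N_δ(s)/Z_δ(s)‖ ≤ M` for all complex `s` within `ρ`
of `[1, √2]`, then for every real `t ∈ [1, √2]` and every `k`,
`‖(N_δ/Z_δ)^{(k)}(t)‖ ≤ M · k! · (2/ρ)^k`: the disc `|s − t| < ρ` lies in the thickening, on it
`N_δ/Z_δ` is a quotient of polynomials (finitely many configurations, `finite_powerset_edgeSet`)
with non-vanishing denominator, and Cauchy's estimates on the circle of radius `ρ/2` apply.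
[folklore] -/
theorem jets_of_thickening_bound : ∀ R : Literature.Probability.RandomPlanarGeometry.ConformalRectangle, ∀ δ : ℝ, 0 < δ → ∀ ρ : ℝ, 0 < ρ → ∀ M : ℝ, (∀ s ∈ Metric.thickening ρ (((↑) : ℝ → ℂ) '' Set.Icc (1:ℝ) (Real.sqrt 2)), (∑ᶠ ω ∈ 𝒫 (Literature.Probability.LatticeModels.discreteDomainGraph R.carrier δ).edgeSet, s ^ (ω.ncard + 2 * Nat.card ((Literature.Probability.Percolation.openGraph ω ⊔ Literature.Probability.LatticeModels.wired (Literature.Probability.LatticeModels.discreteArc R.carrier δ (R.arc 0) ∪ Literature.Probability.LatticeModels.discreteArc R.carrier δ (R.arc 2))).induce (Literature.Probability.LatticeModels.meshDomain R.carrier δ)).ConnectedComponent)) ≠ 0 ∧ ‖(∑ᶠ ω ∈ 𝒫 (Literature.Probability.LatticeModels.discreteDomainGraph R.carrier δ).edgeSet, (Literature.Probability.Percolation.discreteCrossing R.carrier δ (R.arc 0) (R.arc 2)).indicator (fun ω ↦ s ^ (ω.ncard + 2 * Nat.card ((Literature.Probability.Percolation.openGraph ω ⊔ Literature.Probability.LatticeModels.wired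 (Literature.Probability.LatticeModels.discreteArc R.carrier δ (R.arc 0) ∪ Literature.Probability.LatticeModels.discreteArc R.carrier δ (R.arc 2))).induce (Literature.Probability.LatticeModels.meshDomain R.carrier δ)).ConnectedComponent)) ω) / (∑ᶠ ω ∈ 𝒫 (Literature.Probability.LatticeModels.discreteDomainGraph R.carrier δ).edgeSet, s ^ (ω.ncard + 2 * Nat.card ((Literature.Probability.Percolation.openGraph ω ⊔ Literature.Probability.LatticeModels.wired (Literature.Probability.LatticeModels.discreteArc R.carrier δ (R.arc 0) ∪ Literature.Probability.LatticeModels.discreteArc R.carrier δ (R.arc 2))).induce (Literature.Probability.LatticeModels.meshDomain R.carrier δ)).ConnectedComponent))‖ ≤ M) → ∀ t ∈ Set.Icc (1:ℝ) (Real.sqrt 2), ∀ k : ℕ, ‖iteratedDeriv k (fun s ↦ (∑ᶠ ω ∈ 𝒫 (Literature.Probability.LatticeModels.discreteDomainGraph R.carrier δ).edgeSet, (Literature.Probability.Percolation.discreteCrossing R.carrier δ (R.arc 0) (R.arc 2)).indicator (fun ω ↦ s ^ (ω.ncard + 2 * Nat.card ((Literature.Probability.Percolation.openGraph ω ⊔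 Literature.Probability.LatticeModels.wired (Literature.Probability.LatticeModels.discreteArc R.carrier δ (R.arc 0) ∪ Literature.Probability.LatticeModels.discreteArc R.carrier δ (R.arc 2))).induce (Literature.Probability.LatticeModels.meshDomain R.carrier δ)).ConnectedComponent)) ω) / (∑ᶠ ω ∈ 𝒫 (Literature.Probability.LatticeModels.discreteDomainGraph R.carrier δ).edgeSet, s ^ (ω.ncard + 2 * Nat.card ((Literature.Probability.Percolation.openGraph ω ⊔ Literature.Probability.LatticeModels.wired (Literature.Probability.LatticeModels.discreteArc R.carrier δ (R.arc 0) ∪ Literature.Probability.LatticeModels.discreteArc R.carrier δ (R.arc 2))).induce (Literature.Probability.LatticeModels.meshDomain R.carrier δ)).ConnectedComponent))) (t : ℂ)‖ ≤ M * (k.factorial : ℝ) * (2 / ρ) ^ k := by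
  intro R δ hδ ρ hρ M h t ht k
  have hball := jets_ball_ofReal_subset_thickening ht ρ
  have hfin := finite_powerset_edgeSet R.isBounded hδ
  have hdiff := differentiableOn_ratio hfin
    (Literature.Probability.Percolation.discreteCrossing R.carrier δ (R.arc 0) (R.arc 2))
    (fun ω ↦ ω.ncard + 2 * Nat.card ((Literature.Probability.Percolation.openGraph ω ⊔
      Literature.Probability.LatticeModels.wired
        (Literature.Probability.LatticeModels.discreteArc R.carrier δ (R.arc 0) ∪
          Literature.Probability.LatticeModels.discreteArc R.carrier δ (R.arc 2))).induce
      (Literature.Probability.LatticeModels.meshDomain R.carrier δ)).ConnectedComponent)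
    (U := ball (t : ℂ) ρ) fun z hz => (h z (hball hz)).1
  exact norm_iteratedDeriv_le_of_forall_mem_ball hρ hdiff (fun s hs => (h s (hball hs)).2) k

/-- **(J2) The stub POINTWISE in `δ`.** For every conformal rectangle `R` and every mesh `δ > 0`
there are `M` and `A ≥ 0` (depending on `δ`) such that for every real `t ∈ [1, √2]` and every
order `k`, `‖(N_δ/Z_δ)^{(k)}(t)‖ ≤ M · k! · A^k`.  Proof: the pointwise crux
`arcZ_crux_pointwise` gives `ρ > 0`, `M` with `Z_δ ≠ 0`, `‖N_δ/Z_δ‖ ≤ M` on the `ρ`-thickening of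
the segment, and `jets_of_thickening_bound` gives `A = 2/ρ`.  This is the registered stub
`stub_jetsBounded` with the quantifiers `∃ M A` and `∀ᶠ δ` swapped: the whole content of the stub
is the uniformity of `M, A` in `δ`. [folklore] -/
theorem jets_pointwise : ∀ R : Literature.Probability.RandomPlanarGeometry.ConformalRectangle, ∀ δ : ℝ, 0 < δ → ∃ M A : ℝ, 0 ≤ A ∧ ∀ t ∈ Set.Icc (1:ℝ) (Real.sqrt 2), ∀ k : ℕ, ‖iteratedDeriv k (fun s ↦ (∑ᶠ ω ∈ 𝒫 (Literature.Probability.LatticeModels.discreteDomainGraph R.carrier δ).edgeSet, (Literature.Probability.Percolation.discreteCrossing R.carrier δ (R.arc 0) (R.arc 2)).indicator (fun ω ↦ s ^ (ω.ncard + 2 * Nat.card ((Literature.Probability.Percolation.openGraph ω ⊔ Literature.Probability.LatticeModels.wired (Literature.Probability.LatticeModels.discreteArc R.carrier δ (R.arc 0) ∪ Literature.Probability.LatticeModels.discreteArc R.carrier δ (R.arc 2))).induce (Literature.Probability.LatticeModels.meshDomain R.carrier δ)).ConnectedComponent)) ω) / (∑ᶠ ω ∈ 𝒫 (Literature.Probability.LatticeModels.discreteDomainGraph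 R.carrier δ).edgeSet, s ^ (ω.ncard + 2 * Nat.card ((Literature.Probability.Percolation.openGraph ω ⊔ Literature.Probability.LatticeModels.wired (Literature.Probability.LatticeModels.discreteArc R.carrier δ (R.arc 0) ∪ Literature.Probability.LatticeModels.discreteArc R.carrier δ (R.arc 2))).induce (Literature.Probability.LatticeModels.meshDomain R.carrier δ)).ConnectedComponent))) (t : ℂ)‖ ≤ M * (k.factorial : ℝ) * A ^ k := by
  intro R δ hδ
  obtain ⟨ρ, hρ, M, hM⟩ := arcZ_crux_pointwise R δ hδ
  exact ⟨M, 2 / ρ, by positivity, jets_of_thickening_bound R δ hδ ρ hρ M hM⟩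

/-- **(J3) `stub_jetsBounded → FirstJetAtOneBounded`.** The registered stub of the crux (uniform
factorial bounds on all jets of `P_δ = N_δ/Z_δ` at the real points of `[1, √2]`) implies the route
item `FirstJetAtOneBounded` (stmt-CriticalPhenomena-7102): take `k = 1`, `t = 1`
(`iteratedDeriv_one`, `(↑(1:ℝ) : ℂ) = 1`), with the bound `M · A`.  The hypothesis is the stub's
registered statement written out (`dsimp only`-normal form of the route's `let`s). [folklore] -/
theorem jets_firstJetAtOneBounded : (∀ R : Literature.Probability.RandomPlanarGeometry.ConformalRectangle, ∃ M A : ℝ, 0 ≤ A ∧ ∀ᶠ δ in nhdsWithin (0:ℝ) (Set.Ioi 0), ∀ t ∈ Set.Icc (1:ℝ) (Real.sqrt 2), ∀ k : ℕ, ‖iteratedDeriv k (fun s ↦ (∑ᶠ ω ∈ 𝒫 (Literature.Probability.LatticeModels.discreteDomainGraph R.carrier δ).edgeSet, (Literature.Probability.Percolation.discreteCrossing R.carrier δ (R.arc 0) (R.arc 2)).indicator (fun ω ↦ s ^ (ω.ncard + 2 * Nat.card ((Literature.Probability.Percolation.openGraph ω ⊔ Literature.Probability.LatticeModels.wired (Literature.Probability.LatticeModels.discreteArc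 R.carrier δ (R.arc 0) ∪ Literature.Probability.LatticeModels.discreteArc R.carrier δ (R.arc 2))).induce (Literature.Probability.LatticeModels.meshDomain R.carrier δ)).ConnectedComponent)) ω) / (∑ᶠ ω ∈ 𝒫 (Literature.Probability.LatticeModels.discreteDomainGraph R.carrier δ).edgeSet, s ^ (ω.ncard + 2 * Nat.card ((Literature.Probability.Percolation.openGraph ω ⊔ Literature.Probability.LatticeModels.wired (Literature.Probability.LatticeModels.discreteArc R.carrier δ (R.arc 0) ∪ Literature.Probability.LatticeModels.discreteArc R.carrier δ (R.arc 2))).induce (Literature.Probability.LatticeModels.meshDomain R.carrier δ)).ConnectedComponent))) (t : ℂ)‖ ≤ M * (k.factorial : ℝ) * A ^ k) → Summit.CriticalPhenomena.CardyFormulaZ2.Theses.CardyQContinuation.FirstJetAtOneBounded := by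
  intro h
  dsimp only
    [Summit.CriticalPhenomena.CardyFormulaZ2.Theses.CardyQContinuation.FirstJetAtOneBounded]
  intro R
  obtain ⟨M, A, -, hev⟩ := h R
  refine ⟨M * A, ?_⟩
  filter_upwards [hev] with δ hδ
  have h1 := hδ 1 ⟨le_rfl, Real.one_lt_sqrt_two.le⟩ 1
  rw [iteratedDeriv_one, Complex.ofReal_one, Nat.factorial_one, Nat.cast_one, mul_one,
    pow_one] at h1
  exact h1

/-- **(J4) `stub_jetsBounded →` the first jet at `s = √2` stays bounded.** Under the registered
stub, for every conformal rectangle `‖P′_δ(√2)‖ ≤ M · A` for all small `δ` (`k = 1`, `t = √2`).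
The route item `FirstJetConverges` (stmt-CriticalPhenomena-5561) asserts that this jet CONVERGES
as `δ → 0⁺`; only boundedness follows from the stub. [folklore] -/
theorem jets_firstJetAtSqrtTwoBounded : (∀ R : Literature.Probability.RandomPlanarGeometry.ConformalRectangle, ∃ M A : ℝ, 0 ≤ A ∧ ∀ᶠ δ in nhdsWithin (0:ℝ) (Set.Ioi 0), ∀ t ∈ Set.Icc (1:ℝ) (Real.sqrt 2), ∀ k : ℕ, ‖iteratedDeriv k (fun s ↦ (∑ᶠ ω ∈ 𝒫 (Literature.Probability.LatticeModels.discreteDomainGraph R.carrier δ).edgeSet, (Literature.Probability.Percolation.discreteCrossing R.carrier δ (R.arc 0) (R.arc 2)).indicator (fun ω ↦ s ^ (ω.ncard + 2 * Nat.card ((Literature.Probability.Percolation.openGraph ω ⊔ Literature.Probability.LatticeModels.wired (Literature.Probability.LatticeModels.discreteArc R.carrier δ (R.arc 0) ∪ Literature.Probability.LatticeModels.discreteArc R.carrier δ (R.arc 2))).induce (Literature.Probability.LatticeModels.meshDomain R.carrier δ)).ConnectedComponent)) ω) / (∑ᶠ ω ∈ 𝒫 (Literature.Probability.LatticeModels.discreteDomainGraph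 R.carrier δ).edgeSet, s ^ (ω.ncard + 2 * Nat.card ((Literature.Probability.Percolation.openGraph ω ⊔ Literature.Probability.LatticeModels.wired (Literature.Probability.LatticeModels.discreteArc R.carrier δ (R.arc 0) ∪ Literature.Probability.LatticeModels.discreteArc R.carrier δ (R.arc 2))).induce (Literature.Probability.LatticeModels.meshDomain R.carrier δ)).ConnectedComponent))) (t : ℂ)‖ ≤ M * (k.factorial : ℝ) * A ^ k) → ∀ R : Literature.Probability.RandomPlanarGeometry.ConformalRectangle, ∃ M : ℝ, ∀ᶠ δ in nhdsWithin (0:ℝ) (Set.Ioi 0), ‖deriv (fun s ↦ (∑ᶠ ω ∈ 𝒫 (Literature.Probability.LatticeModels.discreteDomainGraph R.carrier δ).edgeSet, (Literature.Probability.Percolation.discreteCrossing R.carrier δ (R.arc 0) (R.arc 2)).indicator (fun ω ↦ s ^ (ω.ncard + 2 * Nat.card ((Literature.Probability.Percolation.openGraph ω ⊔ Literature.Probability.LatticeModels.wired (Literature.Probability.LatticeModels.discreteArc R.carrier δ (R.arc 0) ∪ Literature.Probability.LatticeModels.discreteArc R.carrier δ (R.arc 2))).induce (Literature.Probability.LatticeModels.meshDomain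 R.carrier δ)).ConnectedComponent)) ω) / (∑ᶠ ω ∈ 𝒫 (Literature.Probability.LatticeModels.discreteDomainGraph R.carrier δ).edgeSet, s ^ (ω.ncard + 2 * Nat.card ((Literature.Probability.Percolation.openGraph ω ⊔ Literature.Probability.LatticeModels.wired (Literature.Probability.LatticeModels.discreteArc R.carrier δ (R.arc 0) ∪ Literature.Probability.LatticeModels.discreteArc R.carrier δ (R.arc 2))).induce (Literature.Probability.LatticeModels.meshDomain R.carrier δ)).ConnectedComponent))) (Real.sqrt 2 : ℂ)‖ ≤ M := by
  intro h R
  obtain ⟨M, A, -, hev⟩ := h R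
  refine ⟨M * A, ?_⟩
  filter_upwards [hev] with δ hδ
  have h1 := hδ (Real.sqrt 2) ⟨Real.one_lt_sqrt_two.le, le_rfl⟩ 1
  rw [iteratedDeriv_one, Nat.factorial_one, Nat.cast_one, mul_one, pow_one] at h1
  exact h1

/-- **(J5) Fixed-order slices of the stub.** Under the registered stub, for every conformal
rectangle and every FIXED order `k` the `k`-th jets of `P_δ` are bounded on the whole segment
`[1, √2]` for all small `δ` (bound `M · k! · A^k`).  At `t = √2` these are the jets whose
convergence the route item `IsingJetsConformal` (stmt-CriticalPhenomena-5560) asserts; the stub adds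
the factorial growth in `k`, uniformly in `δ`. [folklore] -/
theorem jets_fixedOrderBounded : (∀ R : Literature.Probability.RandomPlanarGeometry.ConformalRectangle, ∃ M A : ℝ, 0 ≤ A ∧ ∀ᶠ δ in nhdsWithin (0:ℝ) (Set.Ioi 0), ∀ t ∈ Set.Icc (1:ℝ) (Real.sqrt 2), ∀ k : ℕ, ‖iteratedDeriv k (fun s ↦ (∑ᶠ ω ∈ 𝒫 (Literature.Probability.LatticeModels.discreteDomainGraph R.carrier δ).edgeSet, (Literature.Probability.Percolation.discreteCrossing R.carrier δ (R.arc 0) (R.arc 2)).indicator (fun ω ↦ s ^ (ω.ncard + 2 * Nat.card ((Literature.Probability.Percolation.openGraph ω ⊔ Literature.Probability.LatticeModels.wired (Literature.Probability.LatticeModels.discreteArc R.carrier δ (R.arc 0) ∪ Literature.Probability.LatticeModels.discreteArc R.carrier δ (R.arc 2))).induce (Literature.Probability.LatticeModels.meshDomain R.carrier δ)).ConnectedComponent)) ω) / (∑ᶠ ω ∈ 𝒫 (Literature.Probability.LatticeModels.discreteDomainGraph R.carrier δ).edgeSet, s ^ (ω.ncard + 2 * Nat.card ((Literature.Probability.Percolation.openGraph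 ω ⊔ Literature.Probability.LatticeModels.wired (Literature.Probability.LatticeModels.discreteArc R.carrier δ (R.arc 0) ∪ Literature.Probability.LatticeModels.discreteArc R.carrier δ (R.arc 2))).induce (Literature.Probability.LatticeModels.meshDomain R.carrier δ)).ConnectedComponent))) (t : ℂ)‖ ≤ M * (k.factorial : ℝ) * A ^ k) → ∀ R : Literature.Probability.RandomPlanarGeometry.ConformalRectangle, ∀ k : ℕ, ∃ M : ℝ, ∀ᶠ δ in nhdsWithin (0:ℝ) (Set.Ioi 0), ∀ t ∈ Set.Icc (1:ℝ) (Real.sqrt 2), ‖iteratedDeriv k (fun s ↦ (∑ᶠ ω ∈ 𝒫 (Literature.Probability.LatticeModels.discreteDomainGraph R.carrier δ).edgeSet, (Literature.Probability.Percolation.discreteCrossing R.carrier δ (R.arc 0) (R.arc 2)).indicator (fun ω ↦ s ^ (ω.ncard + 2 * Nat.card ((Literature.Probability.Percolation.openGraph ω ⊔ Literature.Probability.LatticeModels.wired (Literature.Probability.LatticeModels.discreteArc R.carrier δ (R.arc 0) ∪ Literature.Probability.LatticeModels.discreteArc R.carrier δ (R.arc 2))).induce (Literature.Probability.LatticeModels.meshDomain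 R.carrier δ)).ConnectedComponent)) ω) / (∑ᶠ ω ∈ 𝒫 (Literature.Probability.LatticeModels.discreteDomainGraph R.carrier δ).edgeSet, s ^ (ω.ncard + 2 * Nat.card ((Literature.Probability.Percolation.openGraph ω ⊔ Literature.Probability.LatticeModels.wired (Literature.Probability.LatticeModels.discreteArc R.carrier δ (R.arc 0) ∪ Literature.Probability.LatticeModels.discreteArc R.carrier δ (R.arc 2))).induce (Literature.Probability.LatticeModels.meshDomain R.carrier δ)).ConnectedComponent))) (t : ℂ)‖ ≤ M := by
  intro h R k
  obtain ⟨M, A, -, hev⟩ := h R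
  refine ⟨M * (k.factorial : ℝ) * A ^ k, ?_⟩
  filter_upwards [hev] with δ hδ
  intro t ht
  exact hδ t ht k

/-- **(J6) A sufficient condition that does not mention the zeros of `Z_δ`.** If `r > 0` and `M`
are such that for all small `δ` and every real `t ∈ [1, √2]` the germ of `P_δ = N_δ/Z_δ` at `t`
agrees with a function holomorphic on the disc `|s − t| < r` and bounded by `M` there, then the
conclusion of `stub_jetsBounded` holds with `A = 2/r`: the jets of `P_δ` at `t` are those of the
extension (`Filter.EventuallyEq.iteratedDeriv_eq`) and Cauchy's estimates apply.  (Zeros of `Z_δ`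
near the segment cancelled to the same order by zeros of `N_δ` are allowed, in contrast to the
crux.) [folklore] -/
theorem jets_of_local_extension : ∀ R : Literature.Probability.RandomPlanarGeometry.ConformalRectangle, ∀ r : ℝ, 0 < r → ∀ M : ℝ, (∀ᶠ δ in nhdsWithin (0:ℝ) (Set.Ioi 0), ∀ t ∈ Set.Icc (1:ℝ) (Real.sqrt 2), ∃ g : ℂ → ℂ, DifferentiableOn ℂ g (Metric.ball (t : ℂ) r) ∧ (∀ z ∈ Metric.ball (t : ℂ) r, ‖g z‖ ≤ M) ∧ (fun s ↦ (∑ᶠ ω ∈ 𝒫 (Literature.Probability.LatticeModels.discreteDomainGraph R.carrier δ).edgeSet, (Literature.Probability.Percolation.discreteCrossing R.carrier δ (R.arc 0) (R.arc 2)).indicator (fun ω ↦ s ^ (ω.ncard + 2 * Nat.card ((Literature.Probability.Percolation.openGraph ω ⊔ Literature.Probability.LatticeModels.wired (Literature.Probability.LatticeModels.discreteArc R.carrier δ (R.arc 0) ∪ Literature.Probability.LatticeModels.discreteArc R.carrier δ (R.arc 2))).induce (Literature.Probability.LatticeModels.meshDomain R.carrier δ)).ConnectedComponent)) ω) / (∑ᶠ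 ω ∈ 𝒫 (Literature.Probability.LatticeModels.discreteDomainGraph R.carrier δ).edgeSet, s ^ (ω.ncard + 2 * Nat.card ((Literature.Probability.Percolation.openGraph ω ⊔ Literature.Probability.LatticeModels.wired (Literature.Probability.LatticeModels.discreteArc R.carrier δ (R.arc 0) ∪ Literature.Probability.LatticeModels.discreteArc R.carrier δ (R.arc 2))).induce (Literature.Probability.LatticeModels.meshDomain R.carrier δ)).ConnectedComponent))) =ᶠ[nhds (t : ℂ)] g) → ∀ᶠ δ in nhdsWithin (0:ℝ) (Set.Ioi 0), ∀ t ∈ Set.Icc (1:ℝ) (Real.sqrt 2), ∀ k : ℕ, ‖iteratedDeriv k (fun s ↦ (∑ᶠ ω ∈ 𝒫 (Literature.Probability.LatticeModels.discreteDomainGraph R.carrier δ).edgeSet, (Literature.Probability.Percolation.discreteCrossing R.carrier δ (R.arc 0) (R.arc 2)).indicator (fun ω ↦ s ^ (ω.ncard + 2 * Nat.card ((Literature.Probability.Percolation.openGraph ω ⊔ Literature.Probability.LatticeModels.wired (Literature.Probability.LatticeModels.discreteArc R.carrier δ (R.arc 0) ∪ Literature.Probability.LatticeModels.discreteArc R.carrier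 δ (R.arc 2))).induce (Literature.Probability.LatticeModels.meshDomain R.carrier δ)).ConnectedComponent)) ω) / (∑ᶠ ω ∈ 𝒫 (Literature.Probability.LatticeModels.discreteDomainGraph R.carrier δ).edgeSet, s ^ (ω.ncard + 2 * Nat.card ((Literature.Probability.Percolation.openGraph ω ⊔ Literature.Probability.LatticeModels.wired (Literature.Probability.LatticeModels.discreteArc R.carrier δ (R.arc 0) ∪ Literature.Probability.LatticeModels.discreteArc R.carrier δ (R.arc 2))).induce (Literature.Probability.LatticeModels.meshDomain R.carrier δ)).ConnectedComponent))) (t : ℂ)‖ ≤ M * (k.factorial : ℝ) * (2 / r) ^ k := by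
  intro R r hr M h
  filter_upwards [h] with δ hδ
  intro t ht k
  obtain ⟨g, hg, hb, heq⟩ := hδ t ht
  rw [heq.iteratedDeriv_eq k]
  exact norm_iteratedDeriv_le_of_forall_mem_ball hr hg hb k

/-! ## The first jet everywhere on the segment (order `k = 1` of the stub) -/

/-- The derivative of a sum of restricted monomials `Σ_F 𝟙_C(a) z^{m a}` at a point `s` is
`Σ_F 𝟙_C(a) (m a) s^{m a - 1}`. [folklore] -/
theorem jets_hasDerivAt_sum_indicator_pow {α : Type*} (F : Finset α) (C : Set α) (m : α → ℕ)
    (s : ℂ) :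
    HasDerivAt (fun z : ℂ => ∑ a ∈ F, C.indicator (fun b => z ^ m b) a)
      (∑ a ∈ F, C.indicator (fun b => (m b : ℂ) * s ^ (m b - 1)) a) s := by
  refine HasDerivAt.fun_sum fun a _ => ?_
  by_cases ha : a ∈ C
  · simp only [Set.indicator_of_mem ha]
    exact hasDerivAt_pow (m a) s
  · simp only [Set.indicator_of_notMem ha]
    exact hasDerivAt_const s 0

/-- The derivative of a sum of monomials `Σ_F z^{m a}` at `s` is `Σ_F (m a) s^{m a - 1}`.
[folklore] -/
theorem jets_hasDerivAt_sum_pow {α : Type*} (F : Finset α) (m : α → ℕ) (s : ℂ) :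
    HasDerivAt (fun z : ℂ => ∑ a ∈ F, z ^ m a) (∑ a ∈ F, (m a : ℂ) * s ^ (m a - 1)) s :=
  HasDerivAt.fun_sum fun a _ => hasDerivAt_pow (m a) s

/-- `m · s^{m-1} · s = m · s^m` (also for `m = 0`, both sides being `0`). [folklore] -/
theorem jets_natCast_mul_pow_pred_mul (m : ℕ) (s : ℂ) :
    (m : ℂ) * s ^ (m - 1) * s = (m : ℂ) * s ^ m := by
  cases m with
  | zero => simp
  | succ n => rw [Nat.add_sub_cancel, mul_assoc, ← pow_succ]

/-- **First-jet covariance identity, finite-sum form.** For a finite index set `F`, an event `C`,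
exponents `m` and a point `s` with `Z(s) = Σ_F s^{m a} ≠ 0`, the ratio
`P = (Σ_F 𝟙_C s^{m a}) / Z` satisfies
`s · P′(s) = (Σ_F 𝟙_C m s^{m}) / Z − P(s) · (Σ_F m s^{m}) / Z`, i.e. at real `s > 0`
`s P′(s) = E_s[𝟙_C m] − E_s[𝟙_C] E_s[m] = Cov_s(𝟙_C, m)` for the Gibbs weights `s^{m a}/Z(s)`
(exponential family in `log s`; Grimmett 2006, Thm 3.12). [folklore] -/
theorem jets_mul_deriv_ratio_finset {α : Type*} (F : Finset α) (C : Set α) (m : α → ℕ) {s : ℂ}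
    (hZ : (∑ a ∈ F, s ^ m a) ≠ 0) :
    s * deriv (fun z : ℂ => (∑ a ∈ F, C.indicator (fun b => z ^ m b) a) / ∑ a ∈ F, z ^ m a) s
      = (∑ a ∈ F, C.indicator (fun b => (m b : ℂ) * s ^ m b) a) / (∑ a ∈ F, s ^ m a)
        - (∑ a ∈ F, C.indicator (fun b => s ^ m b) a) / (∑ a ∈ F, s ^ m a)
          * ((∑ a ∈ F, (m a : ℂ) * s ^ m a) / ∑ a ∈ F, s ^ m a) := by
  rw [((jets_hasDerivAt_sum_indicator_pow F C m s).fun_div (jets_hasDerivAt_sum_pow F m s)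
    hZ).deriv]
  have hN' : s * (∑ a ∈ F, C.indicator (fun b => (m b : ℂ) * s ^ (m b - 1)) a)
      = ∑ a ∈ F, C.indicator (fun b => (m b : ℂ) * s ^ m b) a := by
    rw [Finset.mul_sum]
    refine Finset.sum_congr rfl fun a _ => ?_
    by_cases ha : a ∈ C
    · simp only [Set.indicator_of_mem ha]
      rw [mul_comm, jets_natCast_mul_pow_pred_mul]
    · simp only [Set.indicator_of_notMem ha, mul_zero]
  have hZ' : s * (∑ a ∈ F, (m a : ℂ) * s ^ (m a - 1)) = ∑ a ∈ F, (m a : ℂ) * s ^ m a := by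
    rw [Finset.mul_sum]
    exact Finset.sum_congr rfl fun a _ => by rw [mul_comm, jets_natCast_mul_pow_pred_mul]
  rw [← hN', ← hZ']
  field_simp


/-- **(J7) The first jet everywhere: `s · P′_δ(s) = Cov_s(𝟙_C, L)`.** For a conformal rectangle
`R`, mesh `δ > 0` and any complex `s` with `Z_δ(s) ≠ 0`, writing `L(ω) = |ω| + 2k_B(ω)`:
`s · (N_δ/Z_δ)′(s) = (Σ_ω 𝟙_C L s^L)/Z_δ − (N_δ/Z_δ) · (Σ_ω L s^L)/Z_δ`; at real `s = t > 0` this is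
`E_t[𝟙_C L] − E_t[𝟙_C] E_t[L] = Cov_{φ_t}(𝟙_{C_δ}, L) = P_δ(1 − P_δ)(E_t[L | C_δ] − E_t[L | C_δᶜ])`
under the self-dual FK measure `φ_t ∝ t^L` — the `k = 1` instance of "jets of log-odds =
conditional cumulant differences" behind `stub_jetsBounded` (at `t = 1` it is the Bernoulli
covariance of `deriv_crossingRatio_one`, at `t = √2` the FK-Ising covariance of
`FirstJetConverges`). [folklore] -/
theorem jets_mul_deriv_ratio : ∀ R : Literature.Probability.RandomPlanarGeometry.ConformalRectangle, ∀ δ : ℝ, 0 < δ → ∀ s : ℂ, (∑ᶠ ω ∈ 𝒫 (Literature.Probability.LatticeModels.discreteDomainGraph R.carrier δ).edgeSet, s ^ (ω.ncard + 2 * Nat.card ((Literature.Probability.Percolation.openGraph ω ⊔ Literature.Probability.LatticeModels.wired (Literature.Probability.LatticeModels.discreteArc R.carrier δ (R.arc 0) ∪ Literature.Probability.LatticeModels.discreteArc R.carrier δ (R.arc 2))).induce (Literature.Probability.LatticeModels.meshDomain R.carrier δ)).ConnectedComponent)) ≠ 0 → s * deriv (fun s ↦ (∑ᶠ ω ∈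 𝒫 (Literature.Probability.LatticeModels.discreteDomainGraph R.carrier δ).edgeSet, (Literature.Probability.Percolation.discreteCrossing R.carrier δ (R.arc 0) (R.arc 2)).indicator (fun ω ↦ s ^ (ω.ncard + 2 * Nat.card ((Literature.Probability.Percolation.openGraph ω ⊔ Literature.Probability.LatticeModels.wired (Literature.Probability.LatticeModels.discreteArc R.carrier δ (R.arc 0) ∪ Literature.Probability.LatticeModels.discreteArc R.carrier δ (R.arc 2))).induce (Literature.Probability.LatticeModels.meshDomain R.carrier δ)).ConnectedComponent)) ω) / (∑ᶠ ω ∈ 𝒫 (Literature.Probability.LatticeModels.discreteDomainGraph R.carrier δ).edgeSet, s ^ (ω.ncard + 2 * Nat.card ((Literature.Probability.Percolation.openGraph ω ⊔ Literature.Probability.LatticeModels.wired (Literature.Probability.LatticeModels.discreteArc R.carrier δ (R.arc 0) ∪ Literature.Probability.LatticeModels.discreteArc R.carrier δ (R.arc 2))).induce (Literature.Probability.LatticeModels.meshDomain R.carrier δ)).ConnectedComponent))) s = (∑ᶠ ω ∈ 𝒫 (Literature.Probability.LatticeModels.discreteDomainGraph R.carrier δ).edgeSet, (Literature.Probability.Percolation.discreteCrossing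 R.carrier δ (R.arc 0) (R.arc 2)).indicator (fun ω ↦ ((ω.ncard + 2 * Nat.card ((Literature.Probability.Percolation.openGraph ω ⊔ Literature.Probability.LatticeModels.wired (Literature.Probability.LatticeModels.discreteArc R.carrier δ (R.arc 0) ∪ Literature.Probability.LatticeModels.discreteArc R.carrier δ (R.arc 2))).induce (Literature.Probability.LatticeModels.meshDomain R.carrier δ)).ConnectedComponent : ℕ) : ℂ) * s ^ (ω.ncard + 2 * Nat.card ((Literature.Probability.Percolation.openGraph ω ⊔ Literature.Probability.LatticeModels.wired (Literature.Probability.LatticeModels.discreteArc R.carrier δ (R.arc 0) ∪ Literature.Probability.LatticeModels.discreteArc R.carrier δ (R.arc 2))).induce (Literature.Probability.LatticeModels.meshDomain R.carrier δ)).ConnectedComponent)) ω) / (∑ᶠ ω ∈ 𝒫 (Literature.Probability.LatticeModels.discreteDomainGraph R.carrier δ).edgeSet, s ^ (ω.ncard + 2 * Nat.card ((Literature.Probability.Percolation.openGraph ω ⊔ Literature.Probability.LatticeModels.wired (Literature.Probability.LatticeModels.discreteArc R.carrier δ (R.arc 0) ∪ Literature.Probability.LatticeModels.discreteArc R.carrier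 δ (R.arc 2))).induce (Literature.Probability.LatticeModels.meshDomain R.carrier δ)).ConnectedComponent)) - (∑ᶠ ω ∈ 𝒫 (Literature.Probability.LatticeModels.discreteDomainGraph R.carrier δ).edgeSet, (Literature.Probability.Percolation.discreteCrossing R.carrier δ (R.arc 0) (R.arc 2)).indicator (fun ω ↦ s ^ (ω.ncard + 2 * Nat.card ((Literature.Probability.Percolation.openGraph ω ⊔ Literature.Probability.LatticeModels.wired (Literature.Probability.LatticeModels.discreteArc R.carrier δ (R.arc 0) ∪ Literature.Probability.LatticeModels.discreteArc R.carrier δ (R.arc 2))).induce (Literature.Probability.LatticeModels.meshDomain R.carrier δ)).ConnectedComponent)) ω) / (∑ᶠ ω ∈ 𝒫 (Literature.Probability.LatticeModels.discreteDomainGraph R.carrier δ).edgeSet, s ^ (ω.ncard + 2 * Nat.card ((Literature.Probability.Percolation.openGraph ω ⊔ Literature.Probability.LatticeModels.wired (Literature.Probability.LatticeModels.discreteArc R.carrier δ (R.arc 0) ∪ Literature.Probability.LatticeModels.discreteArc R.carrier δ (R.arc 2))).induce (Literature.Probability.LatticeModels.meshDomain R.carrier δ)).ConnectedComponent)) * ((∑ᶠ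 ω ∈ 𝒫 (Literature.Probability.LatticeModels.discreteDomainGraph R.carrier δ).edgeSet, ((ω.ncard + 2 * Nat.card ((Literature.Probability.Percolation.openGraph ω ⊔ Literature.Probability.LatticeModels.wired (Literature.Probability.LatticeModels.discreteArc R.carrier δ (R.arc 0) ∪ Literature.Probability.LatticeModels.discreteArc R.carrier δ (R.arc 2))).induce (Literature.Probability.LatticeModels.meshDomain R.carrier δ)).ConnectedComponent : ℕ) : ℂ) * s ^ (ω.ncard + 2 * Nat.card ((Literature.Probability.Percolation.openGraph ω ⊔ Literature.Probability.LatticeModels.wired (Literature.Probability.LatticeModels.discreteArc R.carrier δ (R.arc 0) ∪ Literature.Probability.LatticeModels.discreteArc R.carrier δ (R.arc 2))).induce (Literature.Probability.LatticeModels.meshDomain R.carrier δ)).ConnectedComponent)) / (∑ᶠ ω ∈ 𝒫 (Literature.Probability.LatticeModels.discreteDomainGraph R.carrier δ).edgeSet, s ^ (ω.ncard + 2 * Nat.card ((Literature.Probability.Percolation.openGraph ω ⊔ Literature.Probability.LatticeModels.wired (Literature.Probability.LatticeModels.discreteArc R.carrier δ (R.arc 0) ∪ Literature.Probability.LatticeModels.discreteArc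 R.carrier δ (R.arc 2))).induce (Literature.Probability.LatticeModels.meshDomain R.carrier δ)).ConnectedComponent))) := by
  intro R δ hδ s hZ
  have hfin := finite_powerset_edgeSet R.isBounded hδ
  simp only [finsum_mem_eq_finite_toFinset_sum _ hfin] at hZ ⊢
  exact jets_mul_deriv_ratio_finset _ _ _ hZ

/-! ## The trivial rate: the stub in an explicit `δ²`-neighbourhood -/

/-- **The sector, from the distance to the segment.** If `ρ ≤ 1/(4(D+1))`, `t ≥ 1` and
`dist s t < ρ`, then `Re s > 3/4`, `|Im s| < ρ`, hence `D · |arg s| ≤ π/2` and `s ≠ 0` (the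
estimate inside `oddsCone_sector_finset`, isolated). [folklore] -/
theorem jets_sector_of_dist_lt {D : ℕ} {ρ : ℝ} (hρ : ρ ≤ 1 / (4 * ((D : ℝ) + 1))) {s : ℂ} {t : ℝ}
    (ht : 1 ≤ t) (hst : dist s t < ρ) : (D : ℝ) * |Complex.arg s| ≤ π / 2 ∧ s ≠ 0 := by
  have hD : (0 : ℝ) ≤ D := Nat.cast_nonneg D
  have hD1 : (0 : ℝ) < 4 * ((D : ℝ) + 1) := by positivity
  have hρ4 : ρ ≤ 1 / 4 :=
    hρ.trans (one_div_le_one_div_of_le (by norm_num : (0:ℝ) < 4) (by nlinarith))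
  have hre : 3 / 4 < s.re := by
    have h1 : |(s - t).re| ≤ ‖s - (t : ℂ)‖ := Complex.abs_re_le_norm _
    rw [Complex.sub_re, Complex.ofReal_re] at h1
    have h2 : ‖s - (t : ℂ)‖ < ρ := by rwa [← dist_eq_norm]
    have h3 := (abs_lt.1 (h1.trans_lt h2)).1
    linarith
  have him : |s.im| < ρ := by
    have h1 : |(s - t).im| ≤ ‖s - (t : ℂ)‖ := Complex.abs_im_le_norm _
    rw [Complex.sub_im, Complex.ofReal_im, sub_zero] at h1
    have h2 : ‖s - (t : ℂ)‖ < ρ := by rwa [← dist_eq_norm]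
    exact h1.trans_lt h2
  have hre0 : 0 < s.re := by linarith
  refine ⟨?_, fun h0 => by rw [h0, Complex.zero_re] at hre0; exact lt_irrefl 0 hre0⟩
  have harg : |Complex.arg s| ≤ |s.im| / s.re :=
    Literature.Probability.LatticeModels.PetersRegts.abs_arg_le_abs_im_div_re hre0
  have h3 : |Complex.arg s| * s.re ≤ |s.im| := (le_div_iff₀ hre0).1 harg
  have harg' : |Complex.arg s| ≤ 4 * ρ / 3 := by
    have h4 : 0 ≤ |Complex.arg s| * (s.re - 3 / 4) :=
      mul_nonneg (abs_nonneg (Complex.arg s)) (by linarith)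
    nlinarith [abs_nonneg (Complex.arg s), h4]
  have hDρ : (D : ℝ) * ρ ≤ 1 / 4 := by
    have h1 : (D : ℝ) * ρ ≤ D * (1 / (4 * ((D : ℝ) + 1))) := mul_le_mul_of_nonneg_left hρ hD
    have h2 : (D : ℝ) * (1 / (4 * ((D : ℝ) + 1))) ≤ 1 / 4 := by
      rw [mul_one_div, div_le_iff₀ hD1]
      nlinarith
    exact h1.trans h2
  calc (D : ℝ) * |Complex.arg s| ≤ D * (4 * ρ / 3) := mul_le_mul_of_nonneg_left harg' hD
    _ = (D * ρ) * (4 / 3) := by ring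
    _ ≤ (1 / 4) * (4 / 3) := by gcongr
    _ ≤ π / 2 := by linarith [Real.pi_gt_three]

/-- **Zero-freeness in the sector.** If `F` is nonempty, all exponents are `≤ D`, `s ≠ 0` and
`D · |arg s| ≤ π/2`, then `Z(s) = Σ_F s^{m a} ≠ 0`: for `a₀ ∈ F`,
`Re(Z(s) · conj(s^{m a₀})) ≥ |s^{m a₀}|² > 0`, all cross terms having non-negative real part
(`oddsCone_re_pow_mul_conj_pow_nonneg`). [folklore] -/
theorem jets_sum_pow_ne_zero_of_sector {α : Type*} {F : Finset α} (hF : F.Nonempty) (m : α → ℕ)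
    {D : ℕ} (hm : ∀ a ∈ F, m a ≤ D) {s : ℂ} (hs : s ≠ 0)
    (hθ : (D : ℝ) * |Complex.arg s| ≤ π / 2) : (∑ a ∈ F, s ^ m a) ≠ 0 := by
  obtain ⟨a₀, ha₀⟩ := hF
  intro hZ
  have hre : ((∑ a ∈ F, s ^ m a) * conj (s ^ m a₀)).re = 0 := by rw [hZ, zero_mul, Complex.zero_re]
  rw [Finset.sum_mul, Complex.re_sum] at hre
  have hle : (s ^ m a₀ * conj (s ^ m a₀)).re ≤ ∑ a ∈ F, (s ^ m a * conj (s ^ m a₀)).re :=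
    Finset.single_le_sum (f := fun a => (s ^ m a * conj (s ^ m a₀)).re)
      (fun a ha => oddsCone_re_pow_mul_conj_pow_nonneg (hm a ha) (hm a₀ ha₀) hθ) ha₀
  rw [hre, Complex.mul_conj, Complex.ofReal_re] at hle
  exact absurd hle (not_le.2 (Complex.normSq_pos.2 (pow_ne_zero _ hs)))

/-- **`‖N/Z‖ ≤ 1` in the sector.** If all exponents are `≤ D`, `D · |arg s| ≤ π/2` and
`Z(s) = Σ_F s^{m a} ≠ 0`, then `‖N(s)/Z(s)‖ ≤ 1` for `N = Σ_F 𝟙_C s^{m a}`: with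
`N' = Z − N = Σ_F 𝟙_{Cᶜ} s^{m a}`, `|Z|² = |N'|² + |N|² + 2 Re(N' conj N) ≥ |N|²`
(`oddsCone_re_sum_compl_mul_conj_sum_nonneg`). [folklore] -/
theorem jets_norm_ratio_le_one_of_sector {α : Type*} (F : Finset α) (C : Set α) (m : α → ℕ)
    {D : ℕ} (hm : ∀ a ∈ F, m a ≤ D) {s : ℂ} (hθ : (D : ℝ) * |Complex.arg s| ≤ π / 2)
    (hZ : (∑ a ∈ F, s ^ m a) ≠ 0) :
    ‖(∑ a ∈ F, C.indicator (fun b => s ^ m b) a) / ∑ a ∈ F, s ^ m a‖ ≤ 1 := by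
  set Z := ∑ a ∈ F, s ^ m a with hZdef
  set N := ∑ a ∈ F, C.indicator (fun b => s ^ m b) a with hNdef
  set N' := ∑ a ∈ F, Cᶜ.indicator (fun b => s ^ m b) a with hN'def
  have hsplit : Z = N' + N := by
    have h := oddsCone_sum_sub_sum_indicator F C m s
    rw [← hZdef, ← hNdef, ← hN'def] at h
    rw [← h]; ring
  have hcross : 0 ≤ (N' * conj N).re := oddsCone_re_sum_compl_mul_conj_sum_nonneg F C m hm hθ
  have hsq : ‖N‖ ^ 2 ≤ ‖Z‖ ^ 2 := by
    rw [← Complex.normSq_eq_norm_sq, ← Complex.normSq_eq_norm_sq, hsplit, Complex.normSq_add]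
    nlinarith [Complex.normSq_nonneg N']
  have hNZ : ‖N‖ ≤ ‖Z‖ := (pow_le_pow_iff_left₀ (norm_nonneg N) (norm_nonneg Z) two_ne_zero).1 hsq
  rw [norm_div]
  exact (div_le_one (norm_pos_iff.2 hZ)).2 hNZ

/-- **The crux in the explicit sector, finite-sum form.** If `F` is nonempty, all exponents are
`≤ D`, `ρ ≤ 1/(4(D+1))`, `t ≥ 1` and `dist s t < ρ`, then `Z(s) ≠ 0` and `‖N(s)/Z(s)‖ ≤ 1`.
[folklore] -/
theorem jets_crux_sector_finset {α : Type*} {F : Finset α} (hF : F.Nonempty) (C : Set α)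
    (m : α → ℕ) {D : ℕ} (hm : ∀ a ∈ F, m a ≤ D) {ρ : ℝ} (hρ : ρ ≤ 1 / (4 * ((D : ℝ) + 1)))
    {s : ℂ} {t : ℝ} (ht : 1 ≤ t) (hst : dist s t < ρ) :
    (∑ a ∈ F, s ^ m a) ≠ 0 ∧ ‖(∑ a ∈ F, C.indicator (fun b => s ^ m b) a) / ∑ a ∈ F, s ^ m a‖ ≤ 1 := by
  obtain ⟨hθ, hs⟩ := jets_sector_of_dist_lt hρ ht hst
  have hZ := jets_sum_pow_ne_zero_of_sector hF m hm hs hθ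
  exact ⟨hZ, jets_norm_ratio_le_one_of_sector F C m hm hθ hZ⟩

/-- **(J8₀) The crux in an explicit `δ²`-neighbourhood, with `M = 1`.** For every conformal
rectangle `R`, mesh `δ > 0` and every complex `s` within `ρ_δ = 1/(4(D_δ + 1))`,
`D_δ = |E(Ω_δ)| + 2|V(Ω_δ)|`, of the segment `[1, √2]`: `Z_δ(s) ≠ 0` and `‖N_δ(s)/Z_δ(s)‖ ≤ 1`.
(In the sector `D_δ |arg s| ≤ π/2` all cross terms `s^p conj(s^q)`, `p, q ≤ D_δ`, have
non-negative real part, so `Re(Z_δ conj s^{L(∅)}) > 0` and `|Z_δ|² ≥ |N_δ|² + |Z_δ − N_δ|²`.)  This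
quantifies `arcZ_crux_pointwise` (trivial radius `ρ_δ ≍ δ²`, bound `1`); the crux asks for a
`δ`-independent radius. [folklore] -/
theorem jets_crux_sector : ∀ R : Literature.Probability.RandomPlanarGeometry.ConformalRectangle, ∀ δ : ℝ, 0 < δ → ∀ s ∈ Metric.thickening (1 / (4 * (((Literature.Probability.LatticeModels.discreteDomainGraph R.carrier δ).edgeSet.ncard : ℝ) + 2 * ((Literature.Probability.LatticeModels.meshDomain R.carrier δ).ncard : ℝ) + 1))) (((↑) : ℝ → ℂ) '' Set.Icc (1:ℝ) (Real.sqrt 2)), (∑ᶠ ω ∈ 𝒫 (Literature.Probability.LatticeModels.discreteDomainGraph R.carrier δ).edgeSet, s ^ (ω.ncard + 2 * Nat.card ((Literature.Probability.Percolation.openGraph ω ⊔ Literature.Probability.LatticeModels.wired (Literature.Probability.LatticeModels.discreteArc R.carrier δ (R.arc 0) ∪ Literature.Probability.LatticeModels.discreteArc R.carrier δ (R.arc 2))).induce (Literature.Probability.LatticeModels.meshDomain R.carrier δ)).ConnectedComponent)) ≠ 0 ∧ ‖(∑ᶠ ω ∈ 𝒫 (Literature.Probability.LatticeModels.discreteDomainGraph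 R.carrier δ).edgeSet, (Literature.Probability.Percolation.discreteCrossing R.carrier δ (R.arc 0) (R.arc 2)).indicator (fun ω ↦ s ^ (ω.ncard + 2 * Nat.card ((Literature.Probability.Percolation.openGraph ω ⊔ Literature.Probability.LatticeModels.wired (Literature.Probability.LatticeModels.discreteArc R.carrier δ (R.arc 0) ∪ Literature.Probability.LatticeModels.discreteArc R.carrier δ (R.arc 2))).induce (Literature.Probability.LatticeModels.meshDomain R.carrier δ)).ConnectedComponent)) ω) / (∑ᶠ ω ∈ 𝒫 (Literature.Probability.LatticeModels.discreteDomainGraph R.carrier δ).edgeSet, s ^ (ω.ncard + 2 * Nat.card ((Literature.Probability.Percolation.openGraph ω ⊔ Literature.Probability.LatticeModels.wired (Literature.Probability.LatticeModels.discreteArc R.carrier δ (R.arc 0) ∪ Literature.Probability.LatticeModels.discreteArc R.carrier δ (R.arc 2))).induce (Literature.Probability.LatticeModels.meshDomain R.carrier δ)).ConnectedComponent))‖ ≤ 1 := by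
  intro R δ hδ s hs
  have hfin := finite_powerset_edgeSet R.isBounded hδ
  obtain ⟨z, ⟨t, ht, rfl⟩, hst⟩ := Metric.mem_thickening_iff.1 hs
  simp only [finsum_mem_eq_finite_toFinset_sum _ hfin]
  refine jets_crux_sector_finset (arcZ_toFinset_powerset_nonempty R hδ) _ _
    (D := (Literature.Probability.LatticeModels.discreteDomainGraph R.carrier δ).edgeSet.ncard +
      2 * (Literature.Probability.LatticeModels.meshDomain R.carrier δ).ncard)
    (fun ω hω => oddsCone_exponent_le R hδ (hfin.mem_toFinset.1 hω)) (le_of_eq ?_) ht.1 hst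
  push_cast
  ring

/-- **(J8) The trivial rate of the stub: `A_δ = 8(D_δ + 1) ≍ δ⁻²`, `M = 1`.** For every conformal
rectangle `R`, mesh `δ > 0`, real `t ∈ [1, √2]` and order `k`:
`‖(N_δ/Z_δ)^{(k)}(t)‖ ≤ k! · (8(D_δ + 1))^k`, `D_δ = |E(Ω_δ)| + 2|V(Ω_δ)|` — Cauchy's estimates
(`jets_of_thickening_bound`) on the explicit neighbourhood of `jets_crux_sector`.  The registered
stub `stub_jetsBounded` is exactly the assertion that the growth constant `A_δ ≍ δ⁻²` can be
replaced by a `δ`-independent `A`. [folklore] -/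
theorem jets_explicit : ∀ R : Literature.Probability.RandomPlanarGeometry.ConformalRectangle, ∀ δ : ℝ, 0 < δ → ∀ t ∈ Set.Icc (1:ℝ) (Real.sqrt 2), ∀ k : ℕ, ‖iteratedDeriv k (fun s ↦ (∑ᶠ ω ∈ 𝒫 (Literature.Probability.LatticeModels.discreteDomainGraph R.carrier δ).edgeSet, (Literature.Probability.Percolation.discreteCrossing R.carrier δ (R.arc 0) (R.arc 2)).indicator (fun ω ↦ s ^ (ω.ncard + 2 * Nat.card ((Literature.Probability.Percolation.openGraph ω ⊔ Literature.Probability.LatticeModels.wired (Literature.Probability.LatticeModels.discreteArc R.carrier δ (R.arc 0) ∪ Literature.Probability.LatticeModels.discreteArc R.carrier δ (R.arc 2))).induce (Literature.Probability.LatticeModels.meshDomain R.carrier δ)).ConnectedComponent)) ω) / (∑ᶠ ω ∈ 𝒫 (Literature.Probability.LatticeModels.discreteDomainGraph R.carrier δ).edgeSet, s ^ (ω.ncard + 2 * Nat.card ((Literature.Probability.Percolation.openGraph ω ⊔ Literature.Probability.LatticeModels.wired (Literature.Probability.LatticeModels.discreteArc R.carrier δ (R.arc 0) ∪ Literature.Probability.LatticeModels.discreteArc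 R.carrier δ (R.arc 2))).induce (Literature.Probability.LatticeModels.meshDomain R.carrier δ)).ConnectedComponent))) (t : ℂ)‖ ≤ (k.factorial : ℝ) * (8 * (((Literature.Probability.LatticeModels.discreteDomainGraph R.carrier δ).edgeSet.ncard : ℝ) + 2 * ((Literature.Probability.LatticeModels.meshDomain R.carrier δ).ncard : ℝ) + 1)) ^ k := by
  intro R δ hδ t ht k
  have hρ : (0 : ℝ) < (1 / (4 * (((Literature.Probability.LatticeModels.discreteDomainGraph R.carrier δ).edgeSet.ncard : ℝ) + 2 * ((Literature.Probability.LatticeModels.meshDomain R.carrier δ).ncard : ℝ) + 1))) := by positivity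
  refine (jets_of_thickening_bound R δ hδ _ hρ 1 (jets_crux_sector R δ hδ) t ht k).trans_eq ?_
  have h8 : (2 : ℝ) / (1 / (4 * (((Literature.Probability.LatticeModels.discreteDomainGraph R.carrier δ).edgeSet.ncard : ℝ) + 2 * ((Literature.Probability.LatticeModels.meshDomain R.carrier δ).ncard : ℝ) + 1))) = 8 * (((Literature.Probability.LatticeModels.discreteDomainGraph R.carrier δ).edgeSet.ncard : ℝ) + 2 * ((Literature.Probability.LatticeModels.meshDomain R.carrier δ).ncard : ℝ) + 1) := by
    field_simp
    ring
  rw [h8, one_mul]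

end Summit.CriticalPhenomena.CardyFormulaZ2.Theorems.UniformZeroFree
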